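import Summits.HubbardSuperconductivity.HubbardSuperconductivity.Theorems.AnisotropyChordTransferFibre3RowCPsiClasses
import Summits.HubbardSuperconductivity.HubbardSuperconductivity.Theorems.AnisotropyChordTransferFibre3RowCLapNorm
import Summits.HubbardSuperconductivity.HubbardSuperconductivity.Theorems.AnisotropyChordTransferFibre3GroundSup

/-!
# Route `AnisotropyChord` / H0 rotor rung: PartN41-C §3 — `PsiSemiClosed` PROVED (the cross class by Fourier positivity + AM–GM)

Theory-1 g22's PartN41-C §3 `PsiSemiClosed` (port …Fibre3KT2bRow), clauses (4)–(6) and the assembly: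
★ `0 ≤ Σ_a ∇ₓs∇_y s ≤ ¼‖T₀s‖²` (★ `cross_all_nonneg`, ★ `cross_all_le`): by polarised Parseval (★ `parseval_cross`)
`V·Σ_a ∇ₓs∇_y s = Σ_k |ŝ(k)|²·Re((1 − e^{ikₓ})(1 − e^{−ik_y})) = Σ_k |ŝ(k)|²[(1 − cos kₓ)(1 − cos k_y) + sin kₓ sin k_y]`; the odd
`sin·sin` part cancels under the mirror `k ↦ (−k₁, k₂)` because `ŝ` is mirror-symmetric (★ `dft_mirror_of_symm`), and
`0 ≤ (1 − cos kₓ)(1 − cos k_y) ≤ ε(k)²/4` with `FT[T₀s] = εŝ` (`RowC.dft_T0`).  Subtracting the contact part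
(`RowC.cross_contact`) gives `−crossW ≤ ψ_{x,y} ≤ ¼‖T₀s‖² − crossW`; with part 1 (…RowCPsiClasses) ★ `psi_semi_closed` and
★ `psiSemiClosed_holds (Δ) : PsiSemiClosed L Δ`.
Prover seat `hubbard-h0-rotor-p1` g27 (route lead); helper for stmt-HubbardSuperconductivity-23918 (`--supports`, helper class).
WHAT THIS IS NOT: nothing here proves superconductivity in the Hubbard model; the semi-closed form of one input of ONE row of
ONE conditional reduction.  Tree imports only; no new definitions; no sorry, no axioms.
-/

set_option linter.dupNamespace false
set_option autoImplicit false

noncomputable section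

open scoped BigOperators

namespace Summit.HubbardSuperconductivity.HubbardSuperconductivity.Theorems.AnisotropyChord.Transfer.Fibre3

variable (L : ℕ) [NeZero L]

namespace RowC

/-! ## §1 Fourier lemmas -/

/-- `dft` is additive. [folklore] -/
theorem dft_add' (g h : Tor L → ℝ) (k : Tor L) : dft L (fun a => g a + h a) k = dft L g k + dft L h k := by
  unfold dft
  rw [← Finset.sum_add_distrib]
  refine Finset.sum_congr rfl fun a _ => ?_
  push_cast; ring

/-- `dft` respects subtraction. [folklore] -/
theorem dft_sub' (g h : Tor L → ℝ) (k : Tor L) : dft L (fun a => g a - h a) k = dft L g k - dft L h k := by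
  unfold dft
  rw [← Finset.sum_sub_distrib]
  refine Finset.sum_congr rfl fun a _ => ?_
  push_cast; ring

/-- `FT[D_e g](k) = (1 − e^{−ik·e})·ĝ(k)`. [folklore] -/
theorem dft_Dgrad (g : Tor L → ℝ) (e k : Tor L) :
    dft L (fun a => Dgrad L g e a) k = (1 - zPh L k e) * dft L g k := by
  unfold Dgrad
  rw [dft_sub' L g (fun a => g (a - e)) k, OuterMaj.dft_shift_sub]
  ring

/-- ★ POLARISED PARSEVAL: `V·Σ_a g(a)h(a) = Σ_k Re(ĝ(k)·conj ĥ(k))` for real `g, h`. [folklore] -/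
theorem parseval_cross (g h : Tor L → ℝ) :
    (L : ℝ) ^ 2 * ∑ a : Tor L, g a * h a
      = ∑ k : Tor L, (dft L g k * (starRingEnd ℂ) (dft L h k)).re := by
  have hp := normSq_dft_sum L (fun a => g a + h a)
  have hm := normSq_dft_sum L (fun a => g a - h a)
  simp only [dft_add', dft_sub', Complex.normSq_add, Complex.normSq_sub] at hp hm
  have e1 : ∑ k : Tor L, (Complex.normSq (dft L g k) + Complex.normSq (dft L h k)
      + 2 * (dft L g k * (starRingEnd ℂ) (dft L h k)).re)
      - ∑ k : Tor L, (Complex.normSq (dft L g k) + Complex.normSq (dft L h k)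
      - 2 * (dft L g k * (starRingEnd ℂ) (dft L h k)).re)
      = 4 * ∑ k : Tor L, (dft L g k * (starRingEnd ℂ) (dft L h k)).re := by
    rw [← Finset.sum_sub_distrib, Finset.mul_sum]
    exact Finset.sum_congr rfl fun k _ => by ring
  have e2 : (L : ℝ) ^ 2 * ∑ a : Tor L, (g a + h a) ^ 2 - (L : ℝ) ^ 2 * ∑ a : Tor L, (g a - h a) ^ 2
      = 4 * ((L : ℝ) ^ 2 * ∑ a : Tor L, g a * h a) := by
    rw [← mul_sub, ← Finset.sum_sub_distrib, Finset.mul_sum, Finset.mul_sum, Finset.mul_sum]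
    exact Finset.sum_congr rfl fun a _ => by ring
  have hsub : (∑ k : Tor L, (Complex.normSq (dft L g k) + Complex.normSq (dft L h k)
      + 2 * (dft L g k * (starRingEnd ℂ) (dft L h k)).re)
      - ∑ k : Tor L, (Complex.normSq (dft L g k) + Complex.normSq (dft L h k)
      - 2 * (dft L g k * (starRingEnd ℂ) (dft L h k)).re))
      = (L : ℝ) ^ 2 * ∑ a : Tor L, (g a + h a) ^ 2 - (L : ℝ) ^ 2 * ∑ a : Tor L, (g a - h a) ^ 2 := by
    rw [hp, hm]
  rw [e1, e2] at hsub
  linarith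

/-- the mirror `k ↦ (−k₁, k₂)` on phases: `φ_{mk}(r) = φ_k(mr)`. [folklore] -/
theorem phase_mirror_left (k r : Tor L) : phase L (-k.1, k.2) r = phase L k (-r.1, r.2) := by
  rw [phase_eq_phZ, phase_eq_phZ]
  congr 1
  unfold dotZ
  simp only; ring

/-- `φ_{mk}(x̂) = conj φ_k(x̂)` and `φ_{mk}(ŷ) = φ_k(ŷ)`. [folklore] -/
theorem phase_mirror_ex_ey (k : Tor L) :
    phase L (-k.1, k.2) (ex L) = (starRingEnd ℂ) (phase L k (ex L)) ∧ phase L (-k.1, k.2) (ey L) = phase L k (ey L) := by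
  constructor
  · rw [conj_phase, phase_eq_phZ, phase_eq_phZ]
    congr 1
    unfold dotZ ex
    simp
  · rw [phase_eq_phZ, phase_eq_phZ]
    congr 1
    unfold dotZ ey
    simp

/-- ★ a mirror-symmetric real function has a mirror-symmetric transform: `ĝ(−k₁,k₂) = ĝ(k)`. [folklore] -/
theorem dft_mirror_of_symm {g : Tor L → ℝ} (hmi : ∀ r : Tor L, g (-r.1, r.2) = g r) (k : Tor L) :
    dft L g (-k.1, k.2) = dft L g k := by
  unfold dft
  refine Fintype.sum_equiv ⟨fun a => (-a.1, a.2), fun a => (-a.1, a.2), fun a => by simp, fun a => by simp⟩ _ _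
    (fun r => ?_)
  show (starRingEnd ℂ) (phase L (-k.1, k.2) r) * ((g r : ℝ) : ℂ)
    = (starRingEnd ℂ) (phase L k (-r.1, r.2)) * ((g (-r.1, r.2) : ℝ) : ℂ)
  rw [phase_mirror_left, hmi]

/-! ## §2 The cross sum `Σ_a ∇ₓs ∇_y s` in Fourier space -/

omit [NeZero L] in
/-- the Fourier weight of the cross sum: `Re((1 − z̄ₓ)(1 − z_y)·)` written with `c = Re φ`, `s = Im φ`. [folklore] -/
theorem cross_weight (k : Tor L) (w : ℂ) :
    ((1 - zPh L k (ex L)) * w * (starRingEnd ℂ) ((1 - zPh L k (ey L)) * w)).re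
      = Complex.normSq w * ((1 - (phase L k (ex L)).re) * (1 - (phase L k (ey L)).re)
          + (phase L k (ex L)).im * (phase L k (ey L)).im) := by
  unfold zPh
  rw [map_mul, map_sub, map_one, Complex.conj_conj]
  have e : (1 - (starRingEnd ℂ) (phase L k (ex L))) * w * ((1 - phase L k (ey L)) * (starRingEnd ℂ) w)
      = (w * (starRingEnd ℂ) w) * ((1 - (starRingEnd ℂ) (phase L k (ex L))) * (1 - phase L k (ey L))) := by ring
  rw [e, Complex.mul_conj, Complex.re_ofReal_mul]
  congr 1
  simp only [Complex.mul_re, Complex.sub_re, Complex.one_re, Complex.conj_re, Complex.sub_im, Complex.one_im,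
    Complex.conj_im]
  ring

/-- ★ `V·Σ_a ∇ₓs∇_y s = Σ_k |ŝ(k)|²(1 − cos kₓ)(1 − cos k_y)` for a mirror-symmetric `s` (the odd part cancels). [folklore] -/
theorem cross_all_fourier (g : Tor L → ℝ) (hmi : ∀ r : Tor L, g (-r.1, r.2) = g r) :
    (L : ℝ) ^ 2 * ∑ a : Tor L, Dgrad L g (ex L) a * Dgrad L g (ey L) a
      = ∑ k : Tor L, Complex.normSq (dft L g k)
          * ((1 - (phase L k (ex L)).re) * (1 - (phase L k (ey L)).re)) := by
  rw [parseval_cross L (fun a => Dgrad L g (ex L) a) (fun a => Dgrad L g (ey L) a)]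
  simp only [dft_Dgrad, cross_weight]
  -- the odd part vanishes under the mirror
  have hodd : ∑ k : Tor L, Complex.normSq (dft L g k) * ((phase L k (ex L)).im * (phase L k (ey L)).im) = 0 := by
    have hanti : ∑ k : Tor L, Complex.normSq (dft L g k) * ((phase L k (ex L)).im * (phase L k (ey L)).im)
        = ∑ k : Tor L, -(Complex.normSq (dft L g k) * ((phase L k (ex L)).im * (phase L k (ey L)).im)) := by
      refine Fintype.sum_equiv ⟨fun a => (-a.1, a.2), fun a => (-a.1, a.2), fun a => by simp, fun a => by simp⟩ _ _
        (fun k => ?_)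
      show Complex.normSq (dft L g k) * ((phase L k (ex L)).im * (phase L k (ey L)).im)
        = -(Complex.normSq (dft L g (-k.1, k.2)) * ((phase L (-k.1, k.2) (ex L)).im * (phase L (-k.1, k.2) (ey L)).im))
      obtain ⟨h1, h2⟩ := phase_mirror_ex_ey L k
      rw [dft_mirror_of_symm L hmi, h1, h2, Complex.conj_im]
      ring
    rw [Finset.sum_neg_distrib] at hanti
    linarith
  rw [show (∑ k : Tor L, Complex.normSq (dft L g k) * ((1 - (phase L k (ex L)).re) * (1 - (phase L k (ey L)).re)
      + (phase L k (ex L)).im * (phase L k (ey L)).im))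
      = (∑ k : Tor L, Complex.normSq (dft L g k) * ((1 - (phase L k (ex L)).re) * (1 - (phase L k (ey L)).re)))
        + ∑ k : Tor L, Complex.normSq (dft L g k) * ((phase L k (ex L)).im * (phase L k (ey L)).im) from by
    rw [← Finset.sum_add_distrib]; exact Finset.sum_congr rfl fun k _ => by ring]
  rw [hodd, add_zero]

/-- ★ `0 ≤ Σ_a ∇ₓs∇_y s` (mirror-symmetric `s`). [folklore] -/
theorem cross_all_nonneg (g : Tor L → ℝ) (hmi : ∀ r : Tor L, g (-r.1, r.2) = g r) :
    0 ≤ ∑ a : Tor L, Dgrad L g (ex L) a * Dgrad L g (ey L) a := by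
  have hV : (0 : ℝ) < (L : ℝ) ^ 2 := by
    have : (0 : ℝ) < L := by exact_mod_cast Nat.pos_of_ne_zero (NeZero.ne L)
    positivity
  have h := cross_all_fourier L g hmi
  have hnn : 0 ≤ ∑ k : Tor L, Complex.normSq (dft L g k)
      * ((1 - (phase L k (ex L)).re) * (1 - (phase L k (ey L)).re)) := by
    refine Finset.sum_nonneg fun k _ => mul_nonneg (Complex.normSq_nonneg _) (mul_nonneg ?_ ?_)
    · have := (abs_le.mp (abs_re_phase_le L k (ex L))).2; linarith
    · have := (abs_le.mp (abs_re_phase_le L k (ey L))).2; linarith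
  rw [← h] at hnn
  exact (mul_nonneg_iff_of_pos_left hV).mp hnn

/-- ★ `Σ_a ∇ₓs∇_y s ≤ ¼‖T₀s‖²` for the (mirror-symmetric) `s` of a profile `f`. [folklore] -/
theorem cross_all_le (Δ : ℝ) (f : Tor L → ℝ) (hmi : ∀ r : Tor L, sfun' L Δ f (-r.1, r.2) = sfun' L Δ f r) :
    ∑ a : Tor L, Dgrad L (sfun' L Δ f) (ex L) a * Dgrad L (sfun' L Δ f) (ey L) a ≤ lapNormSq L Δ f / 4 := by
  have hV : (0 : ℝ) < (L : ℝ) ^ 2 := by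
    have : (0 : ℝ) < L := by exact_mod_cast Nat.pos_of_ne_zero (NeZero.ne L)
    positivity
  have h := cross_all_fourier L (sfun' L Δ f) hmi
  -- `Σ_k ε²|ŝ|² = V‖T₀s‖²`
  have hT : ∑ k : Tor L, Complex.normSq (dft L (sfun' L Δ f) k) * epsT L k ^ 2 = (L : ℝ) ^ 2 * lapNormSq L Δ f := by
    have hP := normSq_dft_sum L (fun a => ((nnList L).map (fun e => sfun L Δ f a - sfun L Δ f (a - e))).sum / 2)
    have e : ∀ k : Tor L, Complex.normSq (dft L (fun a => ((nnList L).map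
        (fun e => sfun L Δ f a - sfun L Δ f (a - e))).sum / 2) k)
        = Complex.normSq (dft L (sfun' L Δ f) k) * epsT L k ^ 2 := by
      intro k
      rw [dft_T0, Complex.normSq_mul, Complex.normSq_ofReal, sfun'_eq_sfun]; ring
    rw [Finset.sum_congr rfl fun k _ => e k] at hP
    rw [hP]
    rfl
  have hle : ∑ k : Tor L, Complex.normSq (dft L (sfun' L Δ f) k)
      * ((1 - (phase L k (ex L)).re) * (1 - (phase L k (ey L)).re))
      ≤ ∑ k : Tor L, Complex.normSq (dft L (sfun' L Δ f) k) * epsT L k ^ 2 / 4 := by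
    refine Finset.sum_le_sum fun k _ => ?_
    rw [mul_div_assoc]
    refine mul_le_mul_of_nonneg_left ?_ (Complex.normSq_nonneg _)
    rw [epsT_eq_re]
    nlinarith [sq_nonneg ((1 - (phase L k (ex L)).re) - (1 - (phase L k (ey L)).re))]
  rw [← h] at hle
  have e4 : ∑ k : Tor L, Complex.normSq (dft L (sfun' L Δ f) k) * epsT L k ^ 2 / 4
      = ((L : ℝ) ^ 2 * lapNormSq L Δ f) / 4 := by
    rw [← hT, Finset.sum_div]
  rw [e4] at hle
  have : (L : ℝ) ^ 2 * (∑ a : Tor L, Dgrad L (sfun' L Δ f) (ex L) a * Dgrad L (sfun' L Δ f) (ey L) a)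
      ≤ (L : ℝ) ^ 2 * (lapNormSq L Δ f / 4) := by linarith
  exact le_of_mul_le_mul_left this hV

/-! ## §3 Assembly of `PsiSemiClosed` -/

/-- ★ the six clauses of `PsiSemiClosed` (ground profile, `L ≥ 5`, `0 ≤ Δ < 1`). [folklore] -/
theorem psi_semi_closed (hL : 5 ≤ L) {Δ lam2 : ℝ} {f : Tor L → ℝ} (hf : IsGroundTwoMagnon L Δ lam2 f) :
    PsiSum L Δ f = 4 * psiCorr L Δ f (ex L) (ex L) ^ 2 + 4 * psiCorr L Δ f (ex L) (-ex L) ^ 2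
        + 8 * psiCorr L Δ f (ex L) (ey L) ^ 2 ∧
    psiCorr L Δ f (ex L) (ex L) = gradNormSq L Δ f - kapW L lam2 f ∧
    |psiCorr L Δ f (ex L) (-ex L)| ≤ psiCorr L Δ f (ex L) (ex L) ∧
    -crossW L lam2 f ≤ psiCorr L Δ f (ex L) (ey L) ∧
    psiCorr L Δ f (ex L) (ey L) ≤ lapNormSq L Δ f / 4 - crossW L lam2 f ∧
    PsiSum L Δ f ≤ 8 * (gradNormSq L Δ f - kapW L lam2 f) ^ 2
      + 8 * (max (crossW L lam2 f) (lapNormSq L Δ f / 4 - crossW L lam2 f)) ^ 2 := by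
  have heven := hf.2.1
  have hsw : ∀ r : Tor L, f (r.2, r.1) = f r := ground_swap L (by omega) hf
  have hmi : ∀ r : Tor L, f (-r.1, r.2) = f r := ground_mirror L (by omega) hf
  have hL3 : 3 ≤ L := by omega
  have h1 := psiSum_classes L Δ heven hsw hmi
  have h2 := psi_xx_eq L hL3 hf.1 heven hsw hmi
  have h3 := abs_psi_xnx_le L Δ heven
  have hc := cross_contact L hL3 hf.1 heven hsw hmi
  have hsmi : ∀ r : Tor L, sfun' L Δ f (-r.1, r.2) = sfun' L Δ f r := fun r => sfun'_mi L Δ hmi r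
  have h4 := cross_all_nonneg L (sfun' L Δ f) hsmi
  have h5 := cross_all_le L Δ f hsmi
  have c4 : -crossW L lam2 f ≤ psiCorr L Δ f (ex L) (ey L) := by rw [hc]; linarith
  have c5 : psiCorr L Δ f (ex L) (ey L) ≤ lapNormSq L Δ f / 4 - crossW L lam2 f := by rw [hc]; linarith
  refine ⟨h1, h2, h3, c4, c5, ?_⟩
  -- clause (6)
  set M := max (crossW L lam2 f) (lapNormSq L Δ f / 4 - crossW L lam2 f) with hM
  have hxx0 : 0 ≤ psiCorr L Δ f (ex L) (ex L) := (abs_nonneg _).trans h3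
  have hA : psiCorr L Δ f (ex L) (-ex L) ^ 2 ≤ psiCorr L Δ f (ex L) (ex L) ^ 2 := by
    have := abs_le.mp h3
    nlinarith
  have hB : psiCorr L Δ f (ex L) (ey L) ^ 2 ≤ M ^ 2 := by
    have u1 : psiCorr L Δ f (ex L) (ey L) ≤ M := c5.trans (le_max_right _ _)
    have u2 : -psiCorr L Δ f (ex L) (ey L) ≤ M := by linarith [le_max_left (crossW L lam2 f) (lapNormSq L Δ f / 4 - crossW L lam2 f)]
    have hM0 : 0 ≤ M := by
      rcases le_or_gt 0 (psiCorr L Δ f (ex L) (ey L)) with h | h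
      · exact h.trans u1
      · linarith
    nlinarith
  rw [h1, h2] at *
  nlinarith

end RowC

/-- ★ **`PsiSemiClosed L Δ` holds.** [folklore] -/
theorem psiSemiClosed_holds (Δ : ℝ) : PsiSemiClosed L Δ :=
  fun _ _ hL _ _ hf => RowC.psi_semi_closed L hL hf

end Summit.HubbardSuperconductivity.HubbardSuperconductivity.Theorems.AnisotropyChord.Transfer.Fibre3

end
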